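import Summits.MatrixMultiplication.OmegaCensus.STPP222CubeSearch

/-!
# ω-census, `(2,2,2)³` is infeasible in `ℤ/30` — kernel search, part 11 of 11

HONEST FRAMING (pub-omega census; verbatim): lottery ticket; floor = certified bounds/negative ranges.
Census STRUCTURE bookkeeping (question Q7, row `k = 3`, lower half `n₃ ≥ 32`), not progress on `ω`.

Chunks 160–162 of the kernel mask search (`STPP222CubeNeg.searchB3`, `decide +kernel`) over the canonical start list
of `ℤ/30`; assembled with the covering facts in `STPP222CubeNoneZ30.lean`.  Data generated by ENG2 gen 18/19's `cubegen.py`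
(pub-omega HOME `pub-omega-eng2-g19/work/k3/`); predicted kernel time 33 s.

References: H. Cohn, R. Kleinberg, B. Szegedy, C. Umans, FOCS 2005 (arXiv:math/0511460), Def. 5.1.
-/

set_option Elab.async false  -- many kernel pieces: elaborate sequentially (memory)

namespace Summit.MatrixMultiplication.OmegaCensus

namespace STPP222CubeNeg

/-- Start-list chunk 160 of `ℤ/30` (1 entries; 104947 clause evaluations ≈ 9 s predicted). -/
def Z30c.ch160 : List (ℕ × ℕ × ℕ × List ℕ) :=
  [(6, 12, 15, [16])]

/-- Kernel search over chunk 160 of `ℤ/30`. -/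
theorem Z30c.s160 : searchB3 (zArith 30) (List.range 30) Z30c.ch160 = true := by
  decide +kernel

/-- Start-list chunk 161 of `ℤ/30` (1 entries; 192289 clause evaluations ≈ 17 s predicted). -/
def Z30c.ch161 : List (ℕ × ℕ × ℕ × List ℕ) :=
  [(6, 12, 15, [17, 18, 19, 20, 21])]

/-- Kernel search over chunk 161 of `ℤ/30`. -/
theorem Z30c.s161 : searchB3 (zArith 30) (List.range 30) Z30c.ch161 = true := by
  decide +kernel

/-- Start-list chunk 162 of `ℤ/30` (1 entries; 67390 clause evaluations ≈ 6 s predicted). -/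
def Z30c.ch162 : List (ℕ × ℕ × ℕ × List ℕ) :=
  [(6, 12, 15, [22, 23, 24, 25, 26, 27, 28, 29])]

/-- Kernel search over chunk 162 of `ℤ/30`. -/
theorem Z30c.s162 : searchB3 (zArith 30) (List.range 30) Z30c.ch162 = true := by
  decide +kernel

end STPP222CubeNeg

end Summit.MatrixMultiplication.OmegaCensus
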